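import Mathlib

/-!
# The planar LOG-CAPACITY lemma (concentric, sharp constant) — quantitative portrait tool for the
# needle stratum of crux E `PowerGaugeEulerLiouville` (stmt-NavierStokesRegularity-19832; LEAD ns-typeII-p2
# g10's (P1), RESIDUE-MEMO-g10 §2(2) «needles are super-exponentially thin»)

LANDING PLATE t36 prepared by nsreg-p2 g31 (cell ns-regularity-ideate, quantitative seat, DIRECTOR-NS #168 (β))
for a PROVER seat (`--supports stmt-NavierStokesRegularity-19832 --as helper`); the planner lands nothing.
Mathlib only; NO defs (the plate's two abbreviations `annulus w δ = {z | w ≤ ‖z‖ ∧ ‖z‖ ≤ δ}` and `dir θ = cos θ + i sin θ` are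
spelled out at the gate's request — new definitions in Theorems/ are review-queued); 0 sorries; v1.1 (area-robust forms
added 2026-08-28 08:40Z).

THE LEMMA.  Let `f : ℂ → ℝ` be `C¹` on the closed {z : ℂ | `w ≤ ‖z‖ ∧ ‖z‖ ≤ ≤} ‖z‖ ≤ δ` (`0 < w < δ`): `HasFDerivAt f (f' z) z`
there with `f'` continuous on it.  If `f ≥ M` on the inner circle `‖z‖ = w` and `f ≤ m ≤ M` on the outer circle
`‖z‖ = δ`, then

  `∫_{w < ‖z‖ < δ} ‖f'(z)‖² dz ≥ 2π (M − m)² / log(δ/w)`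

(`logCapacity_annulus_lintegral`, Lebesgue-integral form; `logCapacity_disc` the closed-disc / Bochner form with
`f ≥ M` on `D(0,w)`; `logCapacity_disc_of_contDiff` for a globally `C¹` function; `core_radius_le` the thin-core
form `w ≤ δ·exp(−2π(M−m)²/𝓔)` under the energy bound `∫_{D(0,δ)}‖f'‖² ≤ 𝓔`).  The constant is the capacity of the
{z : ℂ | and ≤ ‖z‖ ∧ ‖z‖ ≤ is} attained by `f = log`.  PROOF: along each ray `s ↦ s·u` (`‖u‖ = 1`) the fundamental theorem
of calculus and the weighted AM–GM inequality `‖f'‖ ≤ (λ/2)·s‖f'‖² + (1/2λ)·s⁻¹` with `λ = log(δ/w)/(M − m)`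
give the RAY ESTIMATE `(M − m)² ≤ log(δ/w) · ∫_w^δ s‖f'(s·u)‖² ds` (`ray_sq_le_log_mul_integral`; this is
Cauchy–Schwarz with the weight `1/s`, `∫_w^δ ds/s = log(δ/w)` = `integral_inv_of_pos`); then polar coordinates
(`Complex.lintegral_comp_polarCoord_symm`) and Tonelli on `]w,δ[ × ]−π,π[` (`polar_lintegral_le_annulus`).

AREA-ROBUST FORM (v1.1; what a needle cross-section actually supplies — nothing is asked on any circle):
`logCapacity_annulus_lintegral_of_area` / `logCapacity_disc_of_area` / `core_radius_le_of_area`: if instead of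
`f ≤ m` on the outer circle one only knows that the superlevel set `{f > m}` fills AT MOST HALF of the open annulus,
`|{w < ‖z‖ < δ, f z > m}| ≤ π(δ² − w²)/2`, then `∫ ‖f'‖² ≥ π(M − m)²/log(δ/w)` (half the concentric constant) and
`w ≤ δ·exp(−π(M−m)²/𝓔)`.  PROOF: a ray from the core either MEETS `{f ≤ m}` (escape ray estimate
`ray_sq_le_log_mul_integral_of_escape`) or is BLOCKED inside `{f > m}`; a blocked ray carries polar area
`∫_w^δ s ds = (δ² − w²)/2`, so (polar Chebyshev, `Measurable.lintegral_prod_left'` + the same change of variables in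
the upper-bound direction) the blocked directions have measure `≤ π` — implemented pointwise in `θ` as
`q ≤ (ray integral) + (q/a)·(blocked area on the ray)` and integrated, so no measurability of direction sets is needed.

USE (LEAD g10, 2026-08-28 08:24Z): with the global weighted Dirichlet bound of an exactly self-similar profile and
the fast-inflow floor on a needle cross-section, the lemma bounds the in-radius of the cross-section by
`δ·exp(−2π(M−m)²/Dirichlet energy)` — the kernel form of «needles are super-exponentially thin» (plate P2, separate
file).  WHAT THIS IS NOT: pure real analysis in the plane; no statement about Euler or Navier–Stokes; not crux E.
[folklore: logarithmic capacity of an {z : ℂ | / ≤ ‖z‖ ∧ ‖z‖ ≤ length–area} method (Ahlfors–Beurling); 1D Cauchy–Schwarz]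

(Landed in two files of at most 400 lines for the gate — nsreg-C26-p1 g3 for the author nsreg-p2 g31: this file =
the ray estimates and the MAIN concentric annulus lemma `logCapacity_annulus_lintegral`; the sequel
`…NeedleLogCapacityDisc.lean` = the area-robust annulus form, the disc forms, `radius_le_of_capacity` and the
thin-core bounds `core_radius_le` / `core_radius_le_of_area`.  Declaration names = plate v1.1 (sha16 cd96c19ff2dc6a7d);
statements = the plate's with the two abbreviations spelled out.)
[cite: Mazja1985, §2.2.4 (1)] for the concentric constant; the area-robust form is the length–area method (folklore).
-/

noncomputable section

set_option linter.dupNamespace false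

open MeasureTheory Set Filter Topology
open scoped Real ENNReal

namespace Summit.NavierStokesRegularity.NavierStokesRegularity.Theorems.PowerGaugeEulerLiouville.NeedleLogCapacity

/-- The polar direction `cos θ + i sin θ` has unit norm. [folklore] -/
theorem norm_dir (θ : ℝ) : ‖((Real.cos θ : ℂ) + (Real.sin θ : ℂ) * Complex.I)‖ = 1 := by
  rw [Complex.ofReal_cos, Complex.ofReal_sin]
  exact Complex.norm_cos_add_sin_mul_I θ

/-- The polar direction is continuous in the angle. [folklore] -/
theorem continuous_dir :
    Continuous (fun θ : ℝ => ((Real.cos θ : ℂ) + (Real.sin θ : ℂ) * Complex.I)) :=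
  ((Complex.continuous_ofReal.comp Real.continuous_cos).add
    ((Complex.continuous_ofReal.comp Real.continuous_sin).mul continuous_const))

/-- The inverse polar map is the ray `s·(cos θ + i sin θ)`. [folklore] -/
theorem polarCoord_symm_eq_ray (p : ℝ × ℝ) : Complex.polarCoord.symm p = (p.1 : ℂ) * ((Real.cos p.2 : ℂ) + (Real.sin p.2 : ℂ) * Complex.I) := by
  rw [Complex.polarCoord_symm_apply]

/-- The norm of the ray point `s·u`, `‖u‖ = 1`, `s ≥ 0`, is `s`. [folklore] -/
theorem norm_ray {u : ℂ} (hu : ‖u‖ = 1) {s : ℝ} (hs : 0 ≤ s) : ‖(s : ℂ) * u‖ = s := by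
  rw [norm_mul, hu, mul_one, Complex.norm_real, Real.norm_eq_abs, abs_of_nonneg hs]

/-- **Weighted AM–GM** (the pointwise form of Cauchy–Schwarz with weight `1/s`): for `s, λ > 0` and any real `x`,
`x ≤ (λ/2)·(s x²) + (1/(2λ))·s⁻¹`.  [folklore] -/
theorem weighted_amgm {s l : ℝ} (hs : 0 < s) (hl : 0 < l) (x : ℝ) :
    x ≤ l / 2 * (s * x ^ 2) + 1 / (2 * l) * s⁻¹ := by
  have h2 : 0 < 2 * l * s := by positivity
  have key : l / 2 * (s * x ^ 2) + 1 / (2 * l) * s⁻¹ - x = (l * s * x - 1) ^ 2 / (2 * l * s) := by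
    field_simp
    ring
  have : 0 ≤ (l * s * x - 1) ^ 2 / (2 * l * s) := by positivity
  linarith

/-- **Ray estimate** (1D Cauchy–Schwarz with weight `1/s`).  If `f` is `C¹` on the closed annulus
`w ≤ ‖z‖ ≤ δ` (`0 < w < δ`), `‖u‖ = 1`, `M ≤ f(w u)` and `f(δ u) ≤ m ≤ M`, then
`(M − m)² ≤ log(δ/w) · ∫_w^δ s‖f'(s u)‖² ds`.  [folklore] -/
theorem ray_sq_le_log_mul_integral {f : ℂ → ℝ} {f' : ℂ → ℂ →L[ℝ] ℝ} {w δ m M : ℝ} {u : ℂ}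
    (hw : 0 < w) (hwδ : w < δ) (hu : ‖u‖ = 1)
    (hf : ∀ z ∈ {z : ℂ | w ≤ ‖z‖ ∧ ‖z‖ ≤ δ}, HasFDerivAt f (f' z) z) (hf' : ContinuousOn f' ({z : ℂ | w ≤ ‖z‖ ∧ ‖z‖ ≤ δ}))
    (hM : M ≤ f ((w : ℂ) * u)) (hm : f ((δ : ℂ) * u) ≤ m) (hmM : m ≤ M) :
    (M - m) ^ 2 ≤ Real.log (δ / w) * ∫ s in w..δ, s * ‖f' ((s : ℂ) * u)‖ ^ 2 := by
  have hδ : 0 < δ := hw.trans hwδ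
  set L : ℝ := Real.log (δ / w) with hL_def
  have hL : 0 < L := Real.log_pos ((one_lt_div hw).mpr hwδ)
  -- the ray `s ↦ s u` runs inside the {z : ℂ | for ≤ ‖z‖ ∧ ‖z‖ ≤ `s} ∈ [w, δ]`
  have hray_mem : ∀ s ∈ Icc w δ, ((s : ℂ) * u) ∈ {z : ℂ | w ≤ ‖z‖ ∧ ‖z‖ ≤ δ} := by
    intro s hs
    have hs0 : 0 ≤ s := hw.le.trans hs.1
    refine ⟨?_, ?_⟩ <;> rw [norm_ray hu hs0]
    exacts [hs.1, hs.2]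
  have hray_cont : Continuous fun s : ℝ => (s : ℂ) * u := Complex.continuous_ofReal.mul continuous_const
  have hray_deriv : ∀ s : ℝ, HasDerivAt (fun s : ℝ => (s : ℂ) * u) u s := by
    intro s
    simpa using ((hasDerivAt_id s).ofReal_comp).mul_const u
  -- `g = f ∘ ray`, `g' = f'(ray) u`
  set g : ℝ → ℝ := fun s => f ((s : ℂ) * u) with hg_def
  set g' : ℝ → ℝ := fun s => f' ((s : ℂ) * u) u with hg'_def
  have hg_deriv : ∀ s ∈ uIcc w δ, HasDerivAt g (g' s) s := by
    intro s hs
    rw [uIcc_of_le hwδ.le] at hs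
    exact (hf _ (hray_mem s hs)).comp_hasDerivAt s (hray_deriv s)
  have hF'cont : ContinuousOn (fun s : ℝ => f' ((s : ℂ) * u)) (Icc w δ) :=
    hf'.comp hray_cont.continuousOn hray_mem
  have hg'_cont : ContinuousOn g' (Icc w δ) := hF'cont.clm_apply continuousOn_const
  have hnorm_cont : ContinuousOn (fun s : ℝ => ‖f' ((s : ℂ) * u)‖) (Icc w δ) := hF'cont.norm
  have hB_cont : ContinuousOn (fun s : ℝ => s * ‖f' ((s : ℂ) * u)‖ ^ 2) (Icc w δ) :=
    continuousOn_id.mul (hnorm_cont.pow 2)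
  have hinv_cont : ContinuousOn (fun s : ℝ => s⁻¹) (Icc w δ) := by
    apply ContinuousOn.inv₀ continuousOn_id
    intro s hs
    exact (hw.trans_le hs.1).ne'
  -- interval integrability of everything in sight (continuity on `[w, δ]`)
  have hii : ∀ {φ : ℝ → ℝ}, ContinuousOn φ (Icc w δ) → IntervalIntegrable φ volume w δ := by
    intro φ hφ
    apply ContinuousOn.intervalIntegrable
    rwa [uIcc_of_le hwδ.le]
  have hIg' : IntervalIntegrable g' volume w δ := hii hg'_cont
  have hIA : IntervalIntegrable (fun s : ℝ => ‖f' ((s : ℂ) * u)‖) volume w δ := hii hnorm_cont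
  have hIB : IntervalIntegrable (fun s : ℝ => s * ‖f' ((s : ℂ) * u)‖ ^ 2) volume w δ := hii hB_cont
  have hIinv : IntervalIntegrable (fun s : ℝ => s⁻¹) volume w δ := hii hinv_cont
  -- FTC along the ray: `M − m ≤ g w − g δ = ∫ (−g') ≤ A := ∫ ‖f'(ray)‖`
  have hftc : ∫ s in w..δ, g' s = g δ - g w := intervalIntegral.integral_eq_sub_of_hasDerivAt hg_deriv hIg'
  set A : ℝ := ∫ s in w..δ, ‖f' ((s : ℂ) * u)‖ with hA_def
  set B : ℝ := ∫ s in w..δ, s * ‖f' ((s : ℂ) * u)‖ ^ 2 with hB_def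
  have hA : M - m ≤ A := by
    have h1 : g w - g δ = ∫ s in w..δ, -g' s := by
      rw [intervalIntegral.integral_neg, hftc]; ring
    have h2 : (∫ s in w..δ, -g' s) ≤ A := by
      refine intervalIntegral.integral_mono_on hwδ.le hIg'.neg hIA fun s _ => ?_
      calc -g' s ≤ |g' s| := neg_le_abs _
        _ = ‖f' ((s : ℂ) * u) u‖ := (Real.norm_eq_abs _).symm
        _ ≤ ‖f' ((s : ℂ) * u)‖ * ‖u‖ := (f' _).le_opNorm u
        _ = ‖f' ((s : ℂ) * u)‖ := by rw [hu, mul_one]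
    have h3 : M ≤ g w := hM
    have h4 : g δ ≤ m := hm
    linarith
  have hB_nn : 0 ≤ B :=
    intervalIntegral.integral_nonneg hwδ.le fun s hs => mul_nonneg (hw.le.trans hs.1) (sq_nonneg _)
  -- the case `M = m` is trivial
  rcases hmM.lt_or_eq with hlt | heq
  swap
  · rw [heq, sub_self, zero_pow two_ne_zero]
    exact mul_nonneg hL.le hB_nn
  -- weighted AM–GM with `λ = L/d`, integrated over `[w, δ]`
  set d : ℝ := M - m with hd_def
  have hd : 0 < d := sub_pos.mpr hlt
  set l : ℝ := L / d with hl_def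
  have hl : 0 < l := div_pos hL hd
  have hAle : A ≤ l / 2 * B + 1 / (2 * l) * L := by
    have hpt : ∀ s ∈ Icc w δ,
        ‖f' ((s : ℂ) * u)‖ ≤ l / 2 * (s * ‖f' ((s : ℂ) * u)‖ ^ 2) + 1 / (2 * l) * s⁻¹ :=
      fun s hs => weighted_amgm (hw.trans_le hs.1) hl _
    have hmono := intervalIntegral.integral_mono_on hwδ.le hIA
      ((hIB.const_mul (l / 2)).add (hIinv.const_mul (1 / (2 * l)))) hpt
    rw [intervalIntegral.integral_add (hIB.const_mul (l / 2)) (hIinv.const_mul (1 / (2 * l))),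
      intervalIntegral.integral_const_mul, intervalIntegral.integral_const_mul,
      integral_inv_of_pos hw hδ] at hmono
    exact hmono
  have h3 : 1 / (2 * l) * L = d / 2 := by
    rw [hl_def]; field_simp
  have h4 : d / 2 ≤ l / 2 * B := by linarith
  have h5 : l / 2 * B = L * B / (2 * d) := by
    rw [hl_def]; field_simp
  rw [h5, le_div_iff₀ (by positivity)] at h4
  have h6 : d ^ 2 = d / 2 * (2 * d) := by ring
  rw [h6]
  exact h4

/-- **Ray estimate with an escape point**: as `ray_sq_le_log_mul_integral`, but the ray is only asked to MEET the sublevel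
set `{f ≤ m}` somewhere on `[w, δ]` (not at the end point `δ u`).  [folklore] -/
theorem ray_sq_le_log_mul_integral_of_escape {f : ℂ → ℝ} {f' : ℂ → ℂ →L[ℝ] ℝ} {w δ m M : ℝ} {u : ℂ}
    (hw : 0 < w) (hwδ : w < δ) (hu : ‖u‖ = 1)
    (hf : ∀ z ∈ {z : ℂ | w ≤ ‖z‖ ∧ ‖z‖ ≤ δ}, HasFDerivAt f (f' z) z) (hf' : ContinuousOn f' ({z : ℂ | w ≤ ‖z‖ ∧ ‖z‖ ≤ δ}))
    (hM : M ≤ f ((w : ℂ) * u)) (hesc : ∃ s ∈ Icc w δ, f ((s : ℂ) * u) ≤ m) (hmM : m ≤ M) :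
    (M - m) ^ 2 ≤ Real.log (δ / w) * ∫ s in w..δ, s * ‖f' ((s : ℂ) * u)‖ ^ 2 := by
  obtain ⟨s₀, hs₀, hfs₀⟩ := hesc
  have hL : 0 ≤ Real.log (δ / w) := (Real.log_pos ((one_lt_div hw).mpr hwδ)).le
  have hray_cont : Continuous fun s : ℝ => (s : ℂ) * u := Complex.continuous_ofReal.mul continuous_const
  have hray_mem : MapsTo (fun s : ℝ => (s : ℂ) * u) (Icc w δ) ({z : ℂ | w ≤ ‖z‖ ∧ ‖z‖ ≤ δ}) := by
    intro s hs
    have hs0 : 0 ≤ s := hw.le.trans hs.1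
    refine ⟨?_, ?_⟩ <;> rw [norm_ray hu hs0]
    exacts [hs.1, hs.2]
  have hB_cont : ContinuousOn (fun s : ℝ => s * ‖f' ((s : ℂ) * u)‖ ^ 2) (Icc w δ) :=
    continuousOn_id.mul ((hf'.comp hray_cont.continuousOn hray_mem).norm.pow 2)
  have hIB : IntervalIntegrable (fun s : ℝ => s * ‖f' ((s : ℂ) * u)‖ ^ 2) volume w δ := by
    apply ContinuousOn.intervalIntegrable
    rwa [uIcc_of_le hwδ.le]
  have hB_nn : 0 ≤ ∫ s in w..δ, s * ‖f' ((s : ℂ) * u)‖ ^ 2 :=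
    intervalIntegral.integral_nonneg hwδ.le fun s hs => mul_nonneg (hw.le.trans hs.1) (sq_nonneg _)
  rcases hs₀.1.eq_or_lt with h0 | h0
  · -- the escape point is the inner end point: `M ≤ f (w u) ≤ m`, so `M = m`
    subst h0
    have hzero : M - m = 0 := by linarith
    rw [hzero, zero_pow two_ne_zero]
    exact mul_nonneg hL hB_nn
  · -- `w < s₀ ≤ δ`: the ray estimate on `[w, s₀]`, then monotonicity in the outer radius
    have hsub : {z : ℂ | w ≤ ‖z‖ ∧ ‖z‖ ≤ s₀} ⊆ {z : ℂ | w ≤ ‖z‖ ∧ ‖z‖ ≤ δ} := fun z hz => ⟨hz.1, hz.2.trans hs₀.2⟩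
    have h1 := ray_sq_le_log_mul_integral hw h0 hu (fun z hz => hf z (hsub hz)) (hf'.mono hsub) hM hfs₀ hmM
    have hlog : Real.log (s₀ / w) ≤ Real.log (δ / w) :=
      Real.log_le_log (div_pos (hw.trans h0) hw) (div_le_div_of_nonneg_right hs₀.2 hw.le)
    have hint : ∫ s in w..s₀, s * ‖f' ((s : ℂ) * u)‖ ^ 2 ≤ ∫ s in w..δ, s * ‖f' ((s : ℂ) * u)‖ ^ 2 := by
      apply intervalIntegral.integral_mono_interval le_rfl h0.le hs₀.2 ?_ hIB
      filter_upwards [ae_restrict_mem measurableSet_Ioc] with s hs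
      exact mul_nonneg (hw.le.trans hs.1.le) (sq_nonneg _)
    have hB₀_nn : 0 ≤ ∫ s in w..s₀, s * ‖f' ((s : ℂ) * u)‖ ^ 2 :=
      intervalIntegral.integral_nonneg h0.le fun s hs => mul_nonneg (hw.le.trans hs.1) (sq_nonneg _)
    calc (M - m) ^ 2 ≤ Real.log (s₀ / w) * ∫ s in w..s₀, s * ‖f' ((s : ℂ) * u)‖ ^ 2 := h1
      _ ≤ Real.log (δ / w) * ∫ s in w..δ, s * ‖f' ((s : ℂ) * u)‖ ^ 2 := mul_le_mul hlog hint hB₀_nn hL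

/-- The inner (radial) Lebesgue integral along a ray that starts in `{f ≥ M}` and meets `{f ≤ m}` is at least
`(M − m)²/log(δ/w)` (the escape ray estimate, in `ℝ≥0∞` form). -/
theorem rayLIntegral_ge {f : ℂ → ℝ} {f' : ℂ → ℂ →L[ℝ] ℝ} {w δ m M : ℝ}
    (hw : 0 < w) (hwδ : w < δ)
    (hf : ∀ z ∈ {z : ℂ | w ≤ ‖z‖ ∧ ‖z‖ ≤ δ}, HasFDerivAt f (f' z) z) (hf' : ContinuousOn f' ({z : ℂ | w ≤ ‖z‖ ∧ ‖z‖ ≤ δ}))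
    (θ : ℝ) (hM : M ≤ f ((w : ℂ) * ((Real.cos θ : ℂ) + (Real.sin θ : ℂ) * Complex.I))) (hesc : ∃ s ∈ Icc w δ, f ((s : ℂ) * ((Real.cos θ : ℂ) + (Real.sin θ : ℂ) * Complex.I)) ≤ m) (hmM : m ≤ M) :
    ENNReal.ofReal ((M - m) ^ 2 / Real.log (δ / w)) ≤
      ∫⁻ s in Ioo w δ, ENNReal.ofReal (s * ‖f' ((s : ℂ) * ((Real.cos θ : ℂ) + (Real.sin θ : ℂ) * Complex.I))‖ ^ 2) := by
  have hL : 0 < Real.log (δ / w) := Real.log_pos ((one_lt_div hw).mpr hwδ)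
  have hray := ray_sq_le_log_mul_integral_of_escape hw hwδ (norm_dir θ) hf hf' hM hesc hmM
  have hdiv : (M - m) ^ 2 / Real.log (δ / w) ≤ ∫ s in w..δ, s * ‖f' ((s : ℂ) * ((Real.cos θ : ℂ) + (Real.sin θ : ℂ) * Complex.I))‖ ^ 2 := by
    rw [div_le_iff₀ hL, mul_comm]
    exact hray
  have hray_cont : Continuous fun s : ℝ => (s : ℂ) * ((Real.cos θ : ℂ) + (Real.sin θ : ℂ) * Complex.I) :=
    Complex.continuous_ofReal.mul continuous_const
  have hray_mem : MapsTo (fun s : ℝ => (s : ℂ) * ((Real.cos θ : ℂ) + (Real.sin θ : ℂ) * Complex.I)) (Icc w δ) ({z : ℂ | w ≤ ‖z‖ ∧ ‖z‖ ≤ δ}) := by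
    intro s hs
    have hs0 : 0 ≤ s := hw.le.trans hs.1
    refine ⟨?_, ?_⟩ <;> rw [norm_ray (norm_dir θ) hs0]
    exacts [hs.1, hs.2]
  have hcont : ContinuousOn (fun s : ℝ => s * ‖f' ((s : ℂ) * ((Real.cos θ : ℂ) + (Real.sin θ : ℂ) * Complex.I))‖ ^ 2) (Icc w δ) :=
    continuousOn_id.mul ((hf'.comp hray_cont.continuousOn hray_mem).norm.pow 2)
  have hint : IntegrableOn (fun s : ℝ => s * ‖f' ((s : ℂ) * ((Real.cos θ : ℂ) + (Real.sin θ : ℂ) * Complex.I))‖ ^ 2) (Ioo w δ) :=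
    hcont.integrableOn_Icc.mono_set Ioo_subset_Icc_self
  have hnn : 0 ≤ᵐ[volume.restrict (Ioo w δ)] fun s : ℝ => s * ‖f' ((s : ℂ) * ((Real.cos θ : ℂ) + (Real.sin θ : ℂ) * Complex.I))‖ ^ 2 := by
    filter_upwards [ae_restrict_mem measurableSet_Ioo] with s hs
    exact mul_nonneg (hw.trans hs.1).le (sq_nonneg _)
  calc ENNReal.ofReal ((M - m) ^ 2 / Real.log (δ / w))
      ≤ ENNReal.ofReal (∫ s in Ioo w δ, s * ‖f' ((s : ℂ) * ((Real.cos θ : ℂ) + (Real.sin θ : ℂ) * Complex.I))‖ ^ 2) := by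
        apply ENNReal.ofReal_le_ofReal
        rwa [← integral_Ioc_eq_integral_Ioo, ← intervalIntegral.integral_of_le hwδ.le]
    _ = ∫⁻ s in Ioo w δ, ENNReal.ofReal (s * ‖f' ((s : ℂ) * ((Real.cos θ : ℂ) + (Real.sin θ : ℂ) * Complex.I))‖ ^ 2) :=
        ofReal_integral_eq_lintegral_ofReal hint hnn

/-- **Polar coordinates + Tonelli, lower-bound direction**: the iterated radial–angular Lebesgue integral of
`s ‖f'(s·((Real.cos θ : ℂ) + (Real.sin θ : ℂ) * Complex.I))‖²` over the box `]w,δ[ × ]−π,π[` is at most the Lebesgue integral of `‖f'‖²` over the open annulus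
(`Complex.lintegral_comp_polarCoord_symm`; equality in fact, only `≤` is needed). -/
theorem polar_lintegral_le_annulus {f' : ℂ → ℂ →L[ℝ] ℝ} {w δ : ℝ} (hw : 0 < w)
    (hf' : ContinuousOn f' ({z : ℂ | w ≤ ‖z‖ ∧ ‖z‖ ≤ δ})) :
    ∫⁻ θ in Ioo (-π) π, ∫⁻ s in Ioo w δ, ENNReal.ofReal (s * ‖f' ((s : ℂ) * ((Real.cos θ : ℂ) + (Real.sin θ : ℂ) * Complex.I))‖ ^ 2) ≤
      ∫⁻ z in {z : ℂ | w < ‖z‖ ∧ ‖z‖ < δ}, ‖f' z‖ₑ ^ 2 := by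
  set S : Set ℂ := {z : ℂ | w < ‖z‖ ∧ ‖z‖ < δ} with hS_def
  have hS : MeasurableSet S := by
    have : S = Metric.ball (0 : ℂ) δ \ Metric.closedBall 0 w := by
      ext z
      simp only [hS_def, mem_setOf_eq, Set.mem_sdiff, mem_ball_zero_iff, mem_closedBall_zero_iff, not_le]
      exact and_comm
    rw [this]
    exact measurableSet_ball.diff measurableSet_closedBall
  -- polar coordinates for the indicator-extended integrand
  set F : ℂ → ℝ≥0∞ := S.indicator fun z => ‖f' z‖ₑ ^ 2 with hF_def
  have h1 : ∫⁻ z in S, ‖f' z‖ₑ ^ 2 =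
      ∫⁻ p in polarCoord.target, ENNReal.ofReal p.1 • F (Complex.polarCoord.symm p) := by
    rw [Complex.lintegral_comp_polarCoord_symm F, hF_def, lintegral_indicator hS]
  -- the box inside the polar target, and the integrand there
  set Bx : Set (ℝ × ℝ) := Ioo w δ ×ˢ Ioo (-π) π with hBx_def
  have hBx_sub : Bx ⊆ polarCoord.target := by
    rintro ⟨s, θ⟩ ⟨hs, hθ⟩
    rw [polarCoord_target]
    exact ⟨hw.trans hs.1, hθ⟩
  have hBx_meas : MeasurableSet Bx := measurableSet_Ioo.prod measurableSet_Ioo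
  set G : ℝ × ℝ → ℝ≥0∞ := fun p => ENNReal.ofReal (p.1 * ‖f' ((p.1 : ℂ) * ((Real.cos p.2 : ℂ) + (Real.sin p.2 : ℂ) * Complex.I))‖ ^ 2) with hG_def
  have hFG : ∀ p ∈ Bx, ENNReal.ofReal p.1 • F (Complex.polarCoord.symm p) = G p := by
    rintro ⟨s, θ⟩ ⟨hs, -⟩
    have hs0 : 0 < s := hw.trans hs.1
    have hmem : (s : ℂ) * ((Real.cos θ : ℂ) + (Real.sin θ : ℂ) * Complex.I) ∈ S := by
      refine ⟨?_, ?_⟩ <;> rw [norm_ray (norm_dir θ) hs0.le]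
      exacts [hs.1, hs.2]
    simp only [polarCoord_symm_eq_ray, hF_def, indicator_of_mem hmem, smul_eq_mul, hG_def]
    rw [← ofReal_norm, ← ENNReal.ofReal_pow (norm_nonneg _), ← ENNReal.ofReal_mul hs0.le]
  have hGm : AEMeasurable G (volume.restrict Bx) := by
    have hray : Continuous fun p : ℝ × ℝ => (p.1 : ℂ) * ((Real.cos p.2 : ℂ) + (Real.sin p.2 : ℂ) * Complex.I) :=
      (Complex.continuous_ofReal.comp continuous_fst).mul (continuous_dir.comp continuous_snd)
    have hmaps : MapsTo (fun p : ℝ × ℝ => (p.1 : ℂ) * ((Real.cos p.2 : ℂ) + (Real.sin p.2 : ℂ) * Complex.I)) Bx ({z : ℂ | w ≤ ‖z‖ ∧ ‖z‖ ≤ δ}) := by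
      rintro ⟨s, θ⟩ ⟨hs, -⟩
      have hs0 : 0 ≤ s := (hw.trans hs.1).le
      refine ⟨?_, ?_⟩ <;> simp only [norm_ray (norm_dir θ) hs0]
      exacts [hs.1.le, hs.2.le]
    have hcont : ContinuousOn (fun p : ℝ × ℝ => p.1 * ‖f' ((p.1 : ℂ) * ((Real.cos p.2 : ℂ) + (Real.sin p.2 : ℂ) * Complex.I))‖ ^ 2) Bx :=
      continuousOn_fst.mul ((hf'.comp hray.continuousOn hmaps).norm.pow 2)
    exact ENNReal.measurable_ofReal.comp_aemeasurable (hcont.aemeasurable hBx_meas)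
  -- Tonelli on the box
  have h3 : ∫⁻ p in Bx, G p = ∫⁻ θ in Ioo (-π) π, ∫⁻ s in Ioo w δ, G (s, θ) := by
    have hGm' : AEMeasurable G ((volume.restrict (Ioo w δ)).prod (volume.restrict (Ioo (-π) π))) := by
      rwa [Measure.prod_restrict, ← Measure.volume_eq_prod]
    rw [hBx_def, Measure.volume_eq_prod, ← Measure.prod_restrict, lintegral_prod_symm G hGm']
  show ∫⁻ θ in Ioo (-π) π, ∫⁻ s in Ioo w δ, G (s, θ) ≤ ∫⁻ z in S, ‖f' z‖ₑ ^ 2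
  calc ∫⁻ θ in Ioo (-π) π, ∫⁻ s in Ioo w δ, G (s, θ)
      = ∫⁻ p in Bx, G p := h3.symm
    _ = ∫⁻ p in Bx, ENNReal.ofReal p.1 • F (Complex.polarCoord.symm p) :=
        (setLIntegral_congr_fun hBx_meas hFG).symm
    _ ≤ ∫⁻ p in polarCoord.target, ENNReal.ofReal p.1 • F (Complex.polarCoord.symm p) :=
        lintegral_mono_set hBx_sub
    _ = ∫⁻ z in S, ‖f' z‖ₑ ^ 2 := h1.symm

/-- **Planar log-capacity lemma, {z : ℂ | / ≤ ‖z‖ ∧ ‖z‖ ≤ Lebesgue-integral} form (sharp constant).**  If `f : ℂ → ℝ` is `C¹`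
on the closed {z : ℂ | `w ≤ ‖z‖ ∧ ‖z‖ ≤ ≤} ‖z‖ ≤ δ` (`0 < w < δ`), `f ≥ M` on the circle `‖z‖ = w` and `f ≤ m ≤ M` on the circle
`‖z‖ = δ`, then `∫_{w<‖z‖<δ} ‖f'‖² ≥ 2π(M − m)²/log(δ/w)`.  [folklore: capacity of an annulus] -/
theorem logCapacity_annulus_lintegral {f : ℂ → ℝ} {f' : ℂ → ℂ →L[ℝ] ℝ} {w δ m M : ℝ}
    (hw : 0 < w) (hwδ : w < δ)
    (hf : ∀ z ∈ {z : ℂ | w ≤ ‖z‖ ∧ ‖z‖ ≤ δ}, HasFDerivAt f (f' z) z) (hf' : ContinuousOn f' ({z : ℂ | w ≤ ‖z‖ ∧ ‖z‖ ≤ δ}))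
    (hM : ∀ z : ℂ, ‖z‖ = w → M ≤ f z) (hm : ∀ z : ℂ, ‖z‖ = δ → f z ≤ m) (hmM : m ≤ M) :
    ENNReal.ofReal (2 * π * (M - m) ^ 2 / Real.log (δ / w)) ≤
      ∫⁻ z in {z : ℂ | w < ‖z‖ ∧ ‖z‖ < δ}, ‖f' z‖ₑ ^ 2 := by
  have hδ : 0 < δ := hw.trans hwδ
  have hL : 0 < Real.log (δ / w) := Real.log_pos ((one_lt_div hw).mpr hwδ)
  calc ENNReal.ofReal (2 * π * (M - m) ^ 2 / Real.log (δ / w))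
      = ENNReal.ofReal ((M - m) ^ 2 / Real.log (δ / w)) * volume (Ioo (-π) π) := by
        rw [Real.volume_Ioo, ← ENNReal.ofReal_mul (div_nonneg (sq_nonneg _) hL.le)]
        congr 1
        ring
    _ = ∫⁻ _θ in Ioo (-π) π, ENNReal.ofReal ((M - m) ^ 2 / Real.log (δ / w)) := (setLIntegral_const _ _).symm
    _ ≤ ∫⁻ θ in Ioo (-π) π, ∫⁻ s in Ioo w δ, ENNReal.ofReal (s * ‖f' ((s : ℂ) * ((Real.cos θ : ℂ) + (Real.sin θ : ℂ) * Complex.I))‖ ^ 2) :=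
        lintegral_mono fun θ => rayLIntegral_ge hw hwδ hf hf' θ (hM _ (norm_ray (norm_dir θ) hw.le))
          ⟨δ, right_mem_Icc.mpr hwδ.le, hm _ (norm_ray (norm_dir θ) hδ.le)⟩ hmM
    _ ≤ _ := polar_lintegral_le_annulus hw hf'

end Summit.NavierStokesRegularity.NavierStokesRegularity.Theorems.PowerGaugeEulerLiouville.NeedleLogCapacity

end
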